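import Summits.ValiantsHypothesis.ValiantsHypothesis.Theorems.DefinabilityGapZeroedBlocks
import Summits.ValiantsHypothesis.ValiantsHypothesis.Theorems.DefinabilityGapZeroSpecialisation
import Summits.ValiantsHypothesis.ValiantsHypothesis.Theorems.DefinabilityGapShiftedPrimes
import HarnessLib

/-!
# DefinabilityGap — the pattern-axis substitution: `G_m` hits the unit-triangular width-2 read-once ABPs

Route `route-ValiantsHypothesis-DefinabilityGap` (decomp-valiant cycle 1, lens 5: hardness–randomness / PIT axis); width
ladder of the read-once leaf F4 / W10 (`KIPlantedHittingRO`, stmt-ValiantsHypothesis-23704) of the residual `KIPlantedHitting`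
(23547). `G_m : y ↦ (P_c(y))_c`, `P_c = kiPer m c`, `φ = bind₁ (kiPer m)`.

THE TOOL (third instrument on the width road, after valuations at the primes `P_c − α` (S0) and unique factorisation
(ΣΠΣ(2))): the AXIS SUBSTITUTION `ψ_c = axisHom m c i₀ : ℂ[y] →ₐ[ℂ] ℂ[X]`, `y_x ↦ X` at the diagonal cell `E_c(i₀,i₀)`,
`↦ 1` on the other diagonal cells of block `c`, `↦ 0` elsewhere: (A1) `ψ_c(P_c) = X`; (A2) `ψ_c(P_{c'}) = 0` for
`c' ≠ c`, `m ≥ 3` (a surviving transversal of `c'` would put `m` cells inside `cells c ∩ cells c'`, of size `≤ 2`: the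
NW-design used LINEARLY); (A3) `ψ_c ∘ φ` = evaluation on the `z_c`-axis. RESULTS: (U) `eq_C_of_aeval_kiPer_eq_bind₁`
(`ℂ[P_c] ∩ ℂ[P_{c'} : c' ≠ c] = ℂ` although the `q³` block permanents are dependent); (B) `kiPer_hits_triangularWidthTwo`:
for `m ≥ 3` every nonzero polynomial of an upper-triangular width-2 read-once oblivious ABP
`(1,0)·∏_j [[p_j, q_j],[0, s_j]](z_{c_j})·(a,b)ᵀ` (distinct blocks, ANY order and length, ARBITRARY univariates,
`s_j(0) ≠ 0`; `prod_stepMatrix_mulVec` = the matrix reading) is hit by `G_m`; (B′) `kiPer_hits_affChain`: every affine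
chain `q_1(z_1) + p_1(z_1)·(q_2(z_2) + p_2(z_2)·(… + p_N·a))` (programs over the affine group; top fan-in unbounded).
PROOF of (B): invariant «`φ(F + λ·G) = 0 ⇒ F + λ·G = 0`»; at the head block `ψ_c` gives `F'(0)·p + G'(0)·(q + λ s) = 0`
in `ℂ[X]`, so `q + λ s = μ·p` and `D = p(z_c)·(F' + μ G')` (domain + induction), or `G'(0) = 0 ⇒ b = 0 ⇒ G' = 0`.
PLACEMENT: strictly above S0 (diagonal) and ΣΠΣ(2) — the first non-commuting transition matrices on the road; rung 0 of
23704's width ladder; 0 S-currency; `K1`, `K2c`, `b ≥ 2`, VP ≠ VNP untouched; read-once ⇒ border = exact, no dividend.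

CEILING (what `ψ` cannot do — recorded so nobody re-walks it): `ψ_c` sees only AXIS information (`D(G_m)` restricted to one
seed line; every other block is frozen at its constant term because any seed assignment supported on the `m` diagonal
cells of `c` meets each other block in `≤ 2` cells), hence (i) a chain with an INTERIOR unit failure `s_j(0) = 0`, `j ≥ 2`,
escapes (`γ = 0` without `b = 0`): its diagonal sub-case is S0 (valuations), the mixed case = FULL `U₂` would need `ψ` +
valuations + an «exchange lemma» `r(P_c)·∏_j s_j(P_{c_j}) ∉ φ(ℂ[z_{c'} : c' ≠ c])` for non-constant `r` in the DEPENDENT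
regime `N − 1 ≥ trdeg` — FALSE for abstract dependent families (toy `P₁ = s², P₂ = t², P₃ = st`: `P₃² = P₁P₂`) and
unproved for the planted permanents; (ii) FULL (non-triangular) width 2 stalls exactly when the constant-matrix product
`M₂(0)⋯M_N(0)` kills the propagated vector, and the base point cannot be moved off `0` without moving `≈ q·m²` blocks at
once (a seed cell lies in that many blocks on average), losing isolation — a second idea is needed. Both stay the W10
residual «full width 2 / width q^b», OPEN. 0 sorry.
-/

noncomputable section

open MvPolynomial
open scoped Polynomial
open Literature.Computability.AlgebraicComplexity Literature.Computability.MetaComplexity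

namespace Summit.ValiantsHypothesis.ValiantsHypothesis.Theorems.DefinabilityGapAxisSubstitution

open Summit.ValiantsHypothesis.ValiantsHypothesis.Theorems.DefinabilityGapAffineRung
open Summit.ValiantsHypothesis.ValiantsHypothesis.Theorems.DefinabilityGapZeroedBlocks
open Summit.ValiantsHypothesis.ValiantsHypothesis.Theorems.DefinabilityGapZeroSpecialisation
open Summit.ValiantsHypothesis.ValiantsHypothesis.Theorems.DefinabilityGapShiftedPrimes

variable {m : ℕ}

/-! ## 1. The block permanent under an arbitrary substitution -/

/-- `(aeval f) P_c = Σ_ρ ∏_i f(E_c(ρ i, i))`. [folklore] -/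
theorem aeval_kiPer {A : Type*} [CommRing A] [Algebra ℂ A] (f : Fin (qOf m) × Fin (qOf m) → A)
    (c : Fin 3 → Fin (qOf m)) : aeval f (kiPer m c) = ∑ ρ : Equiv.Perm (Fin m), ∏ i, f (cellEmb m c (ρ i, i)) := by
  classical
  rw [kiPer_eq_rename_cellEmb, perPoly_eq_sum_monomial, map_sum, map_sum]
  refine Finset.sum_congr rfl fun ρ _ => ?_
  rw [rename_monomial, monomial_mapDomain_permMonomial, map_prod]
  simp_rw [aeval_X]

/-! ## 2. The pattern-axis substitution `ψ_c` -/

/-- The diagonal cells `E_c(i,i)` of block `c`. [this file] -/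
def diagCells (m : ℕ) (c : Fin 3 → Fin (qOf m)) : Finset (Fin (qOf m) × Fin (qOf m)) :=
  Finset.univ.image fun i : Fin m => cellEmb m c (i, i)

/-- The axis substitution of block `c` through the diagonal cell `i₀`: `X` at `E_c(i₀,i₀)`, `1` on the other diagonal
cells of `c`, `0` at every other seed cell. [this file] -/
def axisFun (m : ℕ) (c : Fin 3 → Fin (qOf m)) (i₀ : Fin m) (x : Fin (qOf m) × Fin (qOf m)) : ℂ[X] :=
  if x = cellEmb m c (i₀, i₀) then Polynomial.X else if x ∈ diagCells m c then 1 else 0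

/-- `ψ_c : ℂ[y] →ₐ[ℂ] ℂ[X]`. [this file] -/
def axisHom (m : ℕ) (c : Fin 3 → Fin (qOf m)) (i₀ : Fin m) :
    MvPolynomial (Fin (qOf m) × Fin (qOf m)) ℂ →ₐ[ℂ] ℂ[X] :=
  aeval (axisFun m c i₀)

/-- Membership in `diagCells`. [this file] -/
theorem mem_diagCells {c : Fin 3 → Fin (qOf m)} {x : Fin (qOf m) × Fin (qOf m)} :
    x ∈ diagCells m c ↔ ∃ i : Fin m, cellEmb m c (i, i) = x := by simp [diagCells]

/-- The diagonal cells lie in the block. [this file] -/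
theorem diagCells_subset_cells (c : Fin 3 → Fin (qOf m)) : diagCells m c ⊆ cells m c := by
  intro x hx
  obtain ⟨i, rfl⟩ := mem_diagCells.1 hx
  exact Finset.mem_map.2 ⟨(i, i), Finset.mem_univ _, rfl⟩

/-- `ψ_c` on the marked diagonal cell. [this file] -/
theorem axisFun_self (c : Fin 3 → Fin (qOf m)) (i₀ : Fin m) :
    axisFun m c i₀ (cellEmb m c (i₀, i₀)) = Polynomial.X := by simp [axisFun]
/-- `ψ_c` on the other diagonal cells. [this file] -/
theorem axisFun_diag {c : Fin 3 → Fin (qOf m)} {i₀ i : Fin m} (h : i ≠ i₀) :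
    axisFun m c i₀ (cellEmb m c (i, i)) = 1 := by
  have h1 : cellEmb m c (i, i) ≠ cellEmb m c (i₀, i₀) := fun e =>
    h (Prod.ext_iff.1 ((cellEmb m c).injective e)).1
  have h2 : cellEmb m c (i, i) ∈ diagCells m c := mem_diagCells.2 ⟨i, rfl⟩
  simp [axisFun, h1, h2]
/-- `ψ_c` off the diagonal cells. [this file] -/
theorem axisFun_off (c : Fin 3 → Fin (qOf m)) (i₀ : Fin m) {x : Fin (qOf m) × Fin (qOf m)}
    (hx : x ∉ diagCells m c) : axisFun m c i₀ x = 0 := by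
  have h1 : x ≠ cellEmb m c (i₀, i₀) := fun e => hx (e ▸ mem_diagCells.2 ⟨i₀, rfl⟩)
  simp [axisFun, h1, hx]

/-- **(A1)** `ψ_c(P_c) = X`: only the identity transversal survives. [this file] -/
theorem axisHom_kiPer_self (c : Fin 3 → Fin (qOf m)) (i₀ : Fin m) : axisHom m c i₀ (kiPer m c) = Polynomial.X := by
  classical
  rw [axisHom, aeval_kiPer, Finset.sum_eq_single (1 : Equiv.Perm (Fin m))]
  · simp only [Equiv.Perm.coe_one, id_eq]
    rw [← Finset.mul_prod_erase Finset.univ _ (Finset.mem_univ i₀), axisFun_self, Finset.prod_eq_one, mul_one]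
    intro i hi
    exact axisFun_diag (Finset.ne_of_mem_erase hi)
  · intro ρ _ hρ
    obtain ⟨i, hi⟩ : ∃ i, ρ i ≠ i := not_forall.1 fun h => hρ (Equiv.ext fun x => by simpa using h x)
    refine Finset.prod_eq_zero (Finset.mem_univ i) (axisFun_off c i₀ fun hmem => ?_)
    obtain ⟨j, hj⟩ := mem_diagCells.1 hmem
    have e := Prod.ext_iff.1 ((cellEmb m c).injective hj)
    exact hi (e.1.symm.trans e.2)
  · exact fun h => absurd (Finset.mem_univ _) h

/-- **(A2)** `ψ_c(P_{c'}) = 0` for `c' ≠ c` (`m ≥ 3`): two blocks share at most two cells. [this file] -/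
theorem axisHom_kiPer_ne (hm : 3 ≤ m) {c c' : Fin 3 → Fin (qOf m)} (hc : c' ≠ c) (i₀ : Fin m) :
    axisHom m c i₀ (kiPer m c') = 0 := by
  classical
  rw [axisHom, aeval_kiPer]
  refine Finset.sum_eq_zero fun ρ _ => ?_
  by_contra hne
  have hall : ∀ i, cellEmb m c' (ρ i, i) ∈ diagCells m c := fun i => by
    by_contra hi
    exact hne (Finset.prod_eq_zero (Finset.mem_univ i) (axisFun_off c i₀ hi))
  have hsub : (Finset.univ.image fun i : Fin m => cellEmb m c' (ρ i, i)) ⊆ cells m c ∩ cells m c' := by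
    intro x hx
    obtain ⟨i, -, rfl⟩ := Finset.mem_image.1 hx
    exact Finset.mem_inter.2 ⟨diagCells_subset_cells c (hall i), Finset.mem_map.2 ⟨(ρ i, i), Finset.mem_univ _, rfl⟩⟩
  have hcard : (Finset.univ.image fun i : Fin m => cellEmb m c' (ρ i, i)).card = m := by
    rw [Finset.card_image_of_injective _ fun i j hij => (Prod.ext_iff.1 ((cellEmb m c').injective hij)).2,
      Finset.card_univ, Fintype.card_fin]
  have h2 := (Finset.card_le_card hsub).trans (card_cells_inter_le hc.symm)
  omega

/-- **(A3)** `ψ_c(φ E) = E(0)` for `E` not reading `z_c` (`m ≥ 3`). [this file] -/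
theorem axisHom_bind₁_of_not_mem_vars (hm : 3 ≤ m) (c : Fin 3 → Fin (qOf m)) (i₀ : Fin m)
    {E : MvPolynomial (Fin 3 → Fin (qOf m)) ℂ} (hE : c ∉ E.vars) :
    axisHom m c i₀ (bind₁ (kiPer m) E) = Polynomial.C (constantCoeff E) := by
  have hv : ∀ c' ∈ E.vars, (fun c' => axisHom m c i₀ (kiPer m c')) c' = 0 := fun c' hc' =>
    axisHom_kiPer_ne hm (by rintro rfl; exact hE hc') i₀
  rw [← AlgHom.comp_apply, ← aeval_eq_bind₁, comp_aeval, aeval_eq_constantCoeff_of_vars hv, Polynomial.algebraMap_eq]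

/-! ## 3. Univariates in a block variable -/

/-- The univariate `u(z_c)` as a polynomial in the block variables. [this file] -/
def uni (c : Fin 3 → Fin (qOf m)) (u : ℂ[X]) : MvPolynomial (Fin 3 → Fin (qOf m)) ℂ :=
  Polynomial.aeval (X c : MvPolynomial (Fin 3 → Fin (qOf m)) ℂ) u

/-- `uni c` is additive. [this file] -/
theorem uni_add (c : Fin 3 → Fin (qOf m)) (u v : ℂ[X]) : uni c (u + v) = uni c u + uni c v := by simp only [uni, map_add]
/-- `uni c` is multiplicative. [this file] -/
theorem uni_mul (c : Fin 3 → Fin (qOf m)) (u v : ℂ[X]) : uni c (u * v) = uni c u * uni c v := by simp only [uni, map_mul]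
/-- `uni c` on constants. [this file] -/
theorem uni_C (c : Fin 3 → Fin (qOf m)) (r : ℂ) : uni c (Polynomial.C r) = C r := by
  rw [uni, Polynomial.aeval_C, MvPolynomial.algebraMap_eq]
/-- `uni c 0 = 0`. -/ theorem uni_zero (c : Fin 3 → Fin (qOf m)) : uni c (0 : ℂ[X]) = 0 := by simp only [uni, map_zero]
/-- `uni c 1 = 1`. -/ theorem uni_one (c : Fin 3 → Fin (qOf m)) : uni c (1 : ℂ[X]) = 1 := by simp only [uni, map_one]
/-- `φ(u(z_c)) = u(P_c)`. [this file] -/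
theorem bind₁_uni (c : Fin 3 → Fin (qOf m)) (u : ℂ[X]) : bind₁ (kiPer m) (uni c u) = Polynomial.aeval (kiPer m c) u := by
  rw [uni, ← Polynomial.aeval_algHom_apply, bind₁_X_right]
/-- `ψ_c(φ(u(z_c))) = u`. [this file] -/
theorem axisHom_bind₁_uni (c : Fin 3 → Fin (qOf m)) (i₀ : Fin m) (u : ℂ[X]) :
    axisHom m c i₀ (bind₁ (kiPer m) (uni c u)) = u := by
  rw [bind₁_uni, ← Polynomial.aeval_algHom_apply, axisHom_kiPer_self, Polynomial.aeval_X_left_apply]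
/-- The constant term of `u(z_c)` is `u(0)`. [this file] -/
theorem constantCoeff_uni (c : Fin 3 → Fin (qOf m)) (u : ℂ[X]) : constantCoeff (uni c u) = u.coeff 0 := by
  have h := MvPolynomial.aeval_zero (σ := Fin 3 → Fin (qOf m)) (S₁ := ℂ) (uni c u)
  rw [Algebra.algebraMap_self_apply] at h
  rw [← h, uni, ← Polynomial.aeval_algHom_apply, aeval_X, Pi.zero_apply, Polynomial.coeff_zero_eq_aeval_zero]
/-- `u(z_c)` reads only `z_c`. [this file] -/
theorem uni_mem_supported {s : Set (Fin 3 → Fin (qOf m))} {c : Fin 3 → Fin (qOf m)} (hc : c ∈ s) (u : ℂ[X]) :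
    uni c u ∈ supported ℂ s := by
  rw [supported_eq_adjoin_X]
  exact Algebra.adjoin_mono (Set.singleton_subset_iff.2 (Set.mem_image_of_mem X hc))
    (Polynomial.aeval_mem_adjoin_singleton ℂ _)

/-- **(U) The block algebras meet in the constants**: `ℂ[P_c] ∩ ℂ[P_{c'} : c' ≠ c] = ℂ` (`m ≥ 3`). [this file] -/
theorem eq_C_of_aeval_kiPer_eq_bind₁ (hm : 3 ≤ m) (c : Fin 3 → Fin (qOf m)) (r : ℂ[X])
    (E : MvPolynomial (Fin 3 → Fin (qOf m)) ℂ) (hE : c ∉ E.vars) (h : Polynomial.aeval (kiPer m c) r = bind₁ (kiPer m) E) :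
    r = Polynomial.C (constantCoeff E) := by
  have i₀ : Fin m := ⟨0, by omega⟩
  have h1 := congrArg (axisHom m c i₀) h
  rwa [← Polynomial.aeval_algHom_apply, axisHom_kiPer_self, Polynomial.aeval_X_left_apply,
    axisHom_bind₁_of_not_mem_vars hm c i₀ hE] at h1

/-! ## 4. Upper-triangular width-2 read-once chains -/

/-- One transition matrix `[[p, q], [0, s]](z_blk)` of an upper-triangular width-2 read-once oblivious ABP. [this file] -/
structure U2Step (m : ℕ) where
  /-- the block variable read -/
  blk : Fin 3 → Fin (qOf m)
  /-- top-left entry -/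
  p : ℂ[X]
  /-- top-right entry -/
  q : ℂ[X]
  /-- bottom-right entry -/
  s : ℂ[X]

/-- Second coordinate of `∏_j M_j · (a,b)ᵀ`: `b · ∏_j s_j(z_{c_j})`. [this file] -/
def chainG (l : List (U2Step m)) (b : ℂ) : MvPolynomial (Fin 3 → Fin (qOf m)) ℂ :=
  C b * (l.map fun t => uni t.blk t.s).prod

/-- First coordinate of `∏_j M_j · (a,b)ᵀ` = the polynomial computed by the upper-triangular width-2 read-once ABP
`(1,0) · M_1(z_{c_1}) ⋯ M_N(z_{c_N}) · (a,b)ᵀ`: `F(t :: l) = p_t(z_t)·F(l) + q_t(z_t)·G(l)`, `F([]) = a`. [this file] -/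
def chainF : List (U2Step m) → ℂ → ℂ → MvPolynomial (Fin 3 → Fin (qOf m)) ℂ
  | [], a, _ => C a
  | t :: l, a, b => uni t.blk t.p * chainF l a b + uni t.blk t.q * chainG l b

/-- `F([]) = a`. -/ @[simp] theorem chainF_nil (a b : ℂ) : chainF ([] : List (U2Step m)) a b = C a := rfl
/-- The recursion of `F`. [this file] -/
@[simp] theorem chainF_cons (t : U2Step m) (l : List (U2Step m)) (a b : ℂ) :
    chainF (t :: l) a b = uni t.blk t.p * chainF l a b + uni t.blk t.q * chainG l b := rfl
/-- `G([]) = b`. -/ @[simp] theorem chainG_nil (b : ℂ) : chainG ([] : List (U2Step m)) b = C b := by simp [chainG]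
/-- The recursion of `G`. [this file] -/
theorem chainG_cons (t : U2Step m) (l : List (U2Step m)) (b : ℂ) :
    chainG (t :: l) b = uni t.blk t.s * chainG l b := by
  simp only [chainG, List.map_cons, List.prod_cons]
  ring

/-- `G(l)(0) = b · ∏ s_j(0)`. [this file] -/
theorem constantCoeff_chainG (l : List (U2Step m)) (b : ℂ) :
    constantCoeff (chainG l b) = b * (l.map fun t => (t.s).coeff 0).prod := by
  induction l with
  | nil => simp
  | cons t l ih => rw [chainG_cons, map_mul, ih, constantCoeff_uni, List.map_cons, List.prod_cons]; ring

/-- The transition matrix of a step. [this file] -/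
def stepMatrix (t : U2Step m) : Matrix (Fin 2) (Fin 2) (MvPolynomial (Fin 3 → Fin (qOf m)) ℂ) :=
  !![uni t.blk t.p, uni t.blk t.q; 0, uni t.blk t.s]

/-- **Matrix reading**: `(chainF, chainG) = ∏_j M_j · (a, b)ᵀ`. [this file] -/
theorem prod_stepMatrix_mulVec (l : List (U2Step m)) (a b : ℂ) :
    (l.map stepMatrix).prod.mulVec ![C a, C b] = ![chainF l a b, chainG l b] := by
  induction l with
  | nil => simp
  | cons t l ih =>
    rw [List.map_cons, List.prod_cons, ← Matrix.mulVec_mulVec, ih]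
    ext i
    fin_cases i <;> simp [stepMatrix, Matrix.mulVec, dotProduct, Fin.sum_univ_two, chainG_cons]

/-- The blocks of `l` are among those of `t :: l`. [this file] -/
theorem setOf_mem_subset_cons (t : U2Step m) (l : List (U2Step m)) :
    ({c | c ∈ l.map U2Step.blk} : Set (Fin 3 → Fin (qOf m))) ⊆ {c | c ∈ (t :: l).map U2Step.blk} := fun x hx => by
  simp only [Set.mem_setOf_eq, List.map_cons, List.mem_cons] at hx ⊢
  exact Or.inr hx
/-- The chain `G` reads only its own blocks. [this file] -/
theorem chainG_mem_supported (l : List (U2Step m)) (b : ℂ) :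
    chainG l b ∈ supported ℂ {c | c ∈ l.map U2Step.blk} := by
  induction l with
  | nil => rw [mem_supported]; simp [vars_C]
  | cons t l ih =>
    rw [chainG_cons]
    exact Subalgebra.mul_mem _ (uni_mem_supported (by simp) _) (supported_mono (setOf_mem_subset_cons t l) ih)
/-- The chain `F` reads only its own blocks. [this file] -/
theorem chainF_mem_supported (l : List (U2Step m)) (a b : ℂ) :
    chainF l a b ∈ supported ℂ {c | c ∈ l.map U2Step.blk} := by
  induction l with
  | nil => rw [mem_supported]; simp [vars_C]
  | cons t l ih =>
    rw [chainF_cons]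
    exact Subalgebra.add_mem _
      (Subalgebra.mul_mem _ (uni_mem_supported (by simp) _) (supported_mono (setOf_mem_subset_cons t l) ih))
      (Subalgebra.mul_mem _ (uni_mem_supported (by simp) _)
        (supported_mono (setOf_mem_subset_cons t l) (chainG_mem_supported l b)))

/-- A block not read by the chain is not a variable of `F`. [this file] -/
theorem not_mem_vars_chainF {l : List (U2Step m)} {c : Fin 3 → Fin (qOf m)} (hc : c ∉ l.map U2Step.blk) (a b : ℂ) :
    c ∉ (chainF l a b).vars := fun h =>
  hc ((mem_supported.1 (chainF_mem_supported l a b)) (Finset.mem_coe.2 h))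
/-- A block not read by the chain is not a variable of `G`. [this file] -/
theorem not_mem_vars_chainG {l : List (U2Step m)} {c : Fin 3 → Fin (qOf m)} (hc : c ∉ l.map U2Step.blk) (b : ℂ) :
    c ∉ (chainG l b).vars := fun h =>
  hc ((mem_supported.1 (chainG_mem_supported l b)) (Finset.mem_coe.2 h))

/-! ## 5. The triangular width-2 rung -/

/-- The induction: `φ(F + λ·G) = 0 ⇒ F + λ·G = 0` along the chain (`m ≥ 3`, read-once, `s_j(0) ≠ 0`). [this file] -/
theorem chain_add_C_mul_eq_zero (hm : 3 ≤ m) :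
    ∀ l : List (U2Step m), (l.map U2Step.blk).Nodup → (∀ t ∈ l, (t.s).coeff 0 ≠ 0) →
      ∀ a b lam : ℂ, bind₁ (kiPer m) (chainF l a b + C lam * chainG l b) = 0 →
        chainF l a b + C lam * chainG l b = 0 := by
  have i₀ : Fin m := ⟨0, by omega⟩
  intro l
  induction l with
  | nil =>
    intro _ _ a b lam h
    rw [chainF_nil, chainG_nil, ← C_mul, ← C_add] at h ⊢
    rw [bind₁_C_right, C_eq_zero] at h
    exact C_eq_zero.2 h
  | cons t l ih =>
    intro hnd hs a b lam h
    rw [List.map_cons, List.nodup_cons] at hnd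
    have hs' : ∀ t' ∈ l, (t'.s).coeff 0 ≠ 0 := fun t' ht' => hs t' (List.mem_cons_of_mem _ ht')
    have hFv : t.blk ∉ (chainF l a b).vars := not_mem_vars_chainF hnd.1 a b
    have hGv : t.blk ∉ (chainG l b).vars := not_mem_vars_chainG hnd.1 b
    have eX : chainF (t :: l) a b + C lam * chainG (t :: l) b =
        uni t.blk t.p * chainF l a b + uni t.blk (t.q + Polynomial.C lam * t.s) * chainG l b := by
      rw [chainF_cons, chainG_cons, uni_add, uni_mul, uni_C]
      ring
    rw [eX] at h ⊢
    have key : Polynomial.C (constantCoeff (chainF l a b)) * t.p +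
        Polynomial.C (constantCoeff (chainG l b)) * (t.q + Polynomial.C lam * t.s) = 0 := by
      have h2 := congrArg (axisHom m t.blk i₀) h
      rw [map_add, map_mul, map_mul, map_add, map_mul, map_mul, map_zero, axisHom_bind₁_uni, axisHom_bind₁_uni,
        axisHom_bind₁_of_not_mem_vars hm t.blk i₀ hFv, axisHom_bind₁_of_not_mem_vars hm t.blk i₀ hGv] at h2
      linear_combination h2
    by_cases hγ : constantCoeff (chainG l b) = 0
    · have hb : b = 0 := by
        rw [constantCoeff_chainG] at hγ
        rcases mul_eq_zero.1 hγ with hb | hprod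
        · exact hb
        · exfalso
          obtain ⟨t', ht', h0⟩ := List.mem_map.1 (List.prod_eq_zero_iff.1 hprod)
          exact hs' t' ht' h0
      have hG0 : chainG l b = 0 := by rw [hb, chainG, C_0, zero_mul]
      rw [hG0, mul_zero, add_zero] at h ⊢
      rw [map_mul, bind₁_uni] at h
      rcases mul_eq_zero.1 h with hp | hF
      · rw [(aeval_kiPer_eq_zero_iff (by omega) t.blk t.p).1 hp, uni_zero, zero_mul]
      · have h3 := ih hnd.2 hs' a b 0
        rw [C_0, zero_mul, add_zero] at h3
        rw [h3 hF, mul_zero]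
    · obtain ⟨μ, hμ⟩ : ∃ μ : ℂ, t.q + Polynomial.C lam * t.s = Polynomial.C μ * t.p := by
        refine ⟨-((constantCoeff (chainG l b))⁻¹ * constantCoeff (chainF l a b)), ?_⟩
        have e1 := eq_neg_of_add_eq_zero_right key
        have e2 : t.q + Polynomial.C lam * t.s = Polynomial.C (constantCoeff (chainG l b))⁻¹ *
            (Polynomial.C (constantCoeff (chainG l b)) * (t.q + Polynomial.C lam * t.s)) := by
          rw [← mul_assoc, ← Polynomial.C_mul, inv_mul_cancel₀ hγ, Polynomial.C_1, one_mul]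
        rw [e2, e1, Polynomial.C_neg, Polynomial.C_mul]
        ring
      have eX2 : uni t.blk t.p * chainF l a b + uni t.blk (t.q + Polynomial.C lam * t.s) * chainG l b =
          uni t.blk t.p * (chainF l a b + C μ * chainG l b) := by
        rw [hμ, uni_mul, uni_C]
        ring
      rw [eX2] at h ⊢
      rw [map_mul, bind₁_uni] at h
      rcases mul_eq_zero.1 h with hp | hF
      · rw [(aeval_kiPer_eq_zero_iff (by omega) t.blk t.p).1 hp, uni_zero, zero_mul]
      · rw [ih hnd.2 hs' a b μ hF, mul_zero]

/-- **THE TRIANGULAR WIDTH-2 RUNG** (KERNEL, unconditional, `m ≥ 3`; any order, any length, arbitrary univariates): `G_m`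
hits every nonzero `(1,0)·∏_j [[p_j, q_j],[0, s_j]](z_{c_j})·(a,b)ᵀ` with read-once blocks and `s_j(0) ≠ 0`. [this file] -/
theorem kiPer_hits_triangularWidthTwo (hm : 3 ≤ m) (l : List (U2Step m)) (a b : ℂ) (hl : (l.map U2Step.blk).Nodup)
    (hs : ∀ t ∈ l, (t.s).coeff 0 ≠ 0) (hD : chainF l a b ≠ 0) : bind₁ (kiPer m) (chainF l a b) ≠ 0 := by
  intro h
  have h1 := chain_add_C_mul_eq_zero hm l hl hs a b 0
  rw [C_0, zero_mul, add_zero] at h1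
  exact hD (h1 h)

/-! ## 6. Affine chains -/

/-- The affine chain `q_1(z_1) + p_1(z_1)·(q_2(z_2) + p_2(z_2)·(…(q_N + p_N·a)))`. [this file] -/
def affChain : List ((Fin 3 → Fin (qOf m)) × ℂ[X] × ℂ[X]) → ℂ → MvPolynomial (Fin 3 → Fin (qOf m)) ℂ
  | [], a => C a
  | (c, p, q) :: l, a => uni c q + uni c p * affChain l a

/-- An affine step as a unit-triangular step. [this file] -/
def affStep (x : (Fin 3 → Fin (qOf m)) × ℂ[X] × ℂ[X]) : U2Step m := ⟨x.1, x.2.1, x.2.2, 1⟩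
/-- Affine steps have `G = 1`. [this file] -/
theorem chainG_map_affStep (l : List ((Fin 3 → Fin (qOf m)) × ℂ[X] × ℂ[X])) : chainG (l.map affStep) 1 = 1 := by
  induction l with
  | nil => simp
  | cons x l ih => rw [List.map_cons, chainG_cons, ih, mul_one]; exact uni_one _
/-- An affine chain is the unit-triangular chain of its steps. [this file] -/
theorem affChain_eq_chainF (l : List ((Fin 3 → Fin (qOf m)) × ℂ[X] × ℂ[X])) (a : ℂ) :
    affChain l a = chainF (l.map affStep) a 1 := by
  induction l with
  | nil => rfl
  | cons x l ih =>
    obtain ⟨c, p, q⟩ := x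
    rw [List.map_cons, chainF_cons, chainG_map_affStep, ← ih]
    simp only [affChain, affStep, mul_one]
    ring

/-- **AFFINE CHAINS ARE HIT**: `G_m` hits every nonzero `q_1(z_1) + p_1(z_1)·(q_2(z_2) + p_2(z_2)·(…(q_N + p_N·a)))` with
pairwise distinct blocks (`m ≥ 3`; any order, any `N`, arbitrary univariates). [this file] -/
theorem kiPer_hits_affChain (hm : 3 ≤ m) (l : List ((Fin 3 → Fin (qOf m)) × ℂ[X] × ℂ[X])) (a : ℂ)
    (hl : (l.map Prod.fst).Nodup) (hD : affChain l a ≠ 0) : bind₁ (kiPer m) (affChain l a) ≠ 0 := by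
  rw [affChain_eq_chainF] at hD ⊢
  refine kiPer_hits_triangularWidthTwo hm _ a 1 ?_ (fun t ht => ?_) hD
  · rw [List.map_map]
    exact hl
  · obtain ⟨x, -, rfl⟩ := List.mem_map.1 ht
    simp [affStep]

end Summit.ValiantsHypothesis.ValiantsHypothesis.Theorems.DefinabilityGapAxisSubstitution
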